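import Literature.AlgebraicGeometry.Resolution.NearPointTauMonotone
import Literature.AlgebraicGeometry.Resolution.OrderSemicontinuityPointwise
import Literature.AlgebraicGeometry.Resolution.RegularCentreBlowupOrder
import HarnessLib

/-!
# The near point over a point centre with `τ(x) = 2` is unique, closed, and a threefold point (CoP1, Lemma 4.3 (3))

Topic: `Literature/AlgebraicGeometry/Resolution`. [CoP1] = Cossart–Piltant, J. Algebra 320 (2008)
1051–1082, Lemma 4.3 (3), p. 8, for the blowing up `q : X′ → X` of a regular threefold along the
closed point `Y = {x}`:

> "(3) If `τ(x) = 2`, `Y = {x}` and `x′ ∈ q⁻¹(x)` is near `x`, then `x′` is uniquely determined,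
> rational over `x` and has `τ(x′) ≥ τ(x) = 2`."

The tree already has the rationality (`NearPointsPointCentre.lean`,
`IsBlowup.residue_comp_stalkMap_surjective_of_isNear_point`), the inequality `τ(x′) ≥ τ(x)`
(`NearPointTauMonotone.lean`), and uniqueness WITHIN ONE CHART of the blowing up
(`eq_of_near_point_of_near_point`: two near primes `𝔴₁, 𝔴₂ ⊇ 𝔪B_j` of the same chart ring `B_j`
coincide). PROVED here is the SCHEME-LEVEL uniqueness — two near points of `X′` over `x` are EQUAL —
and its consequences used by the termination argument of [CoP1] Prop. 4.4 (case `τ = 2`):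

* `IsBlowup.exists_chartFamily` — all points of `X′` over a point `s ∈ X` lie on ONE family of
  charts `q_j : Spec B_j → X′` (`B_j` the chart rings of `Bl_{J_s}(Spec 𝒪_{X,s})` for generators
  `c` of `J_s`), each computing local rings; this is `IsBlowup.exists_chart_morphism`
  (`BlowupStalkCharts.lean`, Stacks 0804) with the comparison isomorphism
  `Proj 𝒪_{X,s}[J_s t] ≅ X′ ×_X Spec 𝒪_{X,s}` chosen once for all points.
* `comap_eq_and_forall_near_forms_of_chart` — nearness of a point `x′` with `π x′ = s`
  read on such a chart (the form-level hypothesis of the ring-level lemmas), for a point given by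
  an EQUATION `π x′ = s` (bookkeeping around `algebraMap_eval₂Hom_mem_pow_of_isNear`).
* `IsBlowup.eq_of_isNear_of_isNear_point` — **Lemma 4.3 (3), uniqueness**: `τ(x) = 2`, `x′, x″`
  near over the same point `x` ⟹ `x″ = x′`. Proof: in a regular system of parameters adapted to
  `x′` (`IsBlowup.exists_origin_chart_of_isNear_point`: `x′` is the origin of the chart `j`, and by
  Hironaka's Theorem 2 for `ℙ²` the directrix `T_x` lies in `⟨Y_i : i ≠ j⟩`), a near point in a
  chart `j′ ≠ j` would put `Y_j − a Y_{j′}` in `T_x` (`exists_map_eq_span_of_near_point`), which has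
  `Y_j`-coefficient `1` — so every near point over `x` lies in the chart `j`, where the tree's
  chart-level uniqueness applies; the common chart family turns equal primes into equal points.
* `IsBlowup.isClosed_singleton_of_isNear_point` — **the near point is a closed point of `X′`**
  (`x` closed, `X, X′` regular, `Y` a permissible centre with `𝓘_{Y,x} = 𝔪_x`): a specialization
  `z` of `x′` lies over `x`, has `ord_z J′ ≤ μ` (over the centre) and `ord_z J′ ≥ ord_{x′} J′ = μ`
  (orders do not decrease under specialization), so is near, so equals `x′`.
* `IsBlowup.spanFinrank_eq_three_of_isNear_point` — **the near point is again a point of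
  embedding dimension `3`** (the origin of a chart over a regular local ring of dimension `3`,
  `isRegularLocalRing_and_span_originFamily`).

Not here: curve centres (Lemma 4.3 (2), `NearPointsCurveCentre.lean`), and the case `τ(x) = 1`.

## Sources

* V. Cossart, O. Piltant, J. Algebra 320 (2008) 1051–1082, Lemma 4.3 (3), p. 8–9.
  [CossartPiltant2008]
* H. Hironaka, Ann. of Math. 92 (1970) 327–334, Thm. 2. [Hironaka1970]
* The Stacks Project, Tag 0804 (charts of a blowing up). [StacksProject]
-/

noncomputable section

open CategoryTheory CategoryTheory.Limits AlgebraicGeometry TopologicalSpace IsLocalRing MvPolynomial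

namespace Literature.AlgebraicGeometry.Resolution

universe u

open Scheme.IdealSheafData

variable {X X' : Scheme.{u}} {π : X' ⟶ X}

/-! ## One family of charts for all points over a base point -/

set_option maxHeartbeats 800000 in
-- the comparison with `Proj` over `Spec 𝒪_{X,s}` elaborates large terms
/-- **All points of a blowing up over `s` lie on one family of charts.** Let `π : X′ → X` be a
blowing up along `J` (`IsBlowup π J`), `s ∈ X`, and `c₁, …, c_k ∈ 𝒪_{X,s}` generators of `J_s`.
There are morphisms `q_j : Spec B_j → X′`, `B_j = (𝒪_{X,s}[J_s t])_{(c_j t)}` the chart rings of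
`Bl_{J_s}(Spec 𝒪_{X,s})`, lying over `Spec B_j → Spec 𝒪_{X,s} → X`, such that EVERY point `x′` of
`X′` with `π x′ = s` is `q_j 𝔴` for some `j` and some `𝔴 ∈ Spec B_j` at which `q_j` induces an
isomorphism of local rings (the charts `Spec B_j → Proj 𝒪_{X,s}[J_s t] ≅ X′ ×_X Spec 𝒪_{X,s} → X′`,
with ONE comparison isomorphism for all points). [cite: StacksProject, Tag 0804] -/
theorem IsBlowup.exists_chartFamily {J : X.IdealSheafData} (hπ : IsBlowup π J) (s : X) {k : ℕ}
    (c : Fin k → X.presheaf.stalk s) (hc : Ideal.span (Set.range c) = stalkIdeal J s) :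
    ∃ q : ∀ j : Fin k, Spec (.of (chartRing c j)) ⟶ X',
      (∀ j, q j ≫ π = Spec.map (CommRingCat.ofHom (chartBase c j)) ≫ X.fromSpecStalk s) ∧
      ∀ x' : X', π x' = s → ∃ (j : Fin k) (w : Spec (.of (chartRing c j))),
        q j w = x' ∧ IsIso ((q j).stalkMap w) := by
  classical
  have hcj : ∀ j, c j ∈ Ideal.span (Set.range c) := fun j =>
    Ideal.mem_span_range_self (f := c) (x := j)
  haveI : Flat (X.fromSpecStalk s) := flat_fromSpecStalk X s
  -- the base change `P = X' ×_X Spec 𝒪_{X,s} → Spec 𝒪_{X,s}` is a blowing up along `(J_s)~ = (c)~`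
  have hP : IsBlowup (pullback.snd π (X.fromSpecStalk s))
      (affineBlowup.idealSheaf (Ideal.span (Set.range c))) := by
    have h := hπ.pullback_snd_of_flat (X.fromSpecStalk s)
    rwa [comap_fromSpecStalk_eq_affineBlowupIdealSheaf, ← hc] at h
  -- hence isomorphic to `Proj 𝒪_{X,s}[J_s t]` over `Spec 𝒪_{X,s}`, once for all points
  obtain ⟨e, he, -⟩ := (affineBlowup.isBlowup (Ideal.span (Set.range c))).unique hP
  refine ⟨fun j => (affineBlowup.chartι (c j) (hcj j) ≫ e.hom) ≫
    pullback.fst π (X.fromSpecStalk s), fun j => ?_, fun x' hx' => ?_⟩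
  · rw [Category.assoc, pullback.condition, Category.assoc, reassoc_of% he, ← Category.assoc,
      affineBlowup.chartι_π (c j) (hcj j)]
  · -- the point of `P` over `x'`, moved to `Proj` and into a chart
    obtain ⟨y, hy⟩ := mem_range_pullback_fst_fromSpecStalk_of_eq π s hx'
    obtain ⟨z, rfl⟩ : ∃ z, e.hom z = y := ⟨e.inv y, by simp⟩
    have hz : z ∈ (⊤ : (affineBlowup (Ideal.span (Set.range c))).Opens) := trivial
    rw [← affineBlowup.iSup_chartOpen_eq_top c rfl] at hz
    obtain ⟨j, hzj⟩ := Opens.mem_iSup.mp hz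
    obtain ⟨w, -, rfl⟩ := hzj
    refine ⟨j, w, hy, ?_⟩
    -- isomorphism on local rings: an open immersion followed by a pro-open immersion
    have h1 := isIso_stalkMap_pullback_fst_fromSpecStalk π s
      ((affineBlowup.chartι (c j) (hcj j) ≫ e.hom) w)
    have h2 : IsIso ((affineBlowup.chartι (c j) (hcj j) ≫ e.hom).stalkMap w) := inferInstance
    rw [Scheme.Hom.stalkMap_comp]
    exact @IsIso.comp_isIso _ _ _ _ _ _ _ h1 h2

/-- **Nearness read on a chart, for a point given by an equation `π x′ = s`.** In the situation of
`IsBlowup.exists_chartFamily` for the blowing up along a centre `Y` (`c` generators of `𝓘_{Y,s}`),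
if `x′ = q 𝔴` for a chart `q : Spec B_j → X′` over `Spec B_j → Spec 𝒪_{X,s} → X` computing the
local ring at `𝔴`, and `x′` is near for `(J, μ)`, then `𝔴` lies over `𝔪_s` and every form `F` of
degree `μ` with `F(c) ∈ J_s` has weak transform in `𝔴^μ (B_j)_𝔴`.
[cite: CossartPiltant2008, proof of Prop. 4.2, (11)] -/
theorem comap_eq_and_forall_near_forms_of_chart [IsLocallyNoetherian X]
    [IsLocallyNoetherian X'] {Y : Closeds X} {J : X.IdealSheafData} {μ : ℕ} {x' : X'} {s : X} (hs : π x' = s) {k : ℕ}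
    {c : Fin k → X.presheaf.stalk s} (hcY : Ideal.span (Set.range c) = stalkIdeal (vanishingIdeal Y) s)
    (j : Fin k) (w : PrimeSpectrum (chartRing c j)) (q : Spec (.of (chartRing c j)) ⟶ X')
    (hq : q w = x') [IsIso (q.stalkMap w)]
    (hsq : q ≫ π = Spec.map (CommRingCat.ofHom (chartBase c j)) ≫ X.fromSpecStalk s)
    (hnear : IsNear π (vanishingIdeal Y) J μ x') :
    w.asIdeal.comap (chartBase c j) = maximalIdeal (X.presheaf.stalk s) ∧
      ∀ F : MvPolynomial (Fin k) (X.presheaf.stalk s), F.IsHomogeneous μ →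
        MvPolynomial.eval c F ∈ stalkIdeal J s →
        (algebraMap (chartRing c j) (Localization.AtPrime w.asIdeal) :
            chartRing c j →+* Localization.AtPrime w.asIdeal)
            (MvPolynomial.eval₂Hom (chartBase c j) (fun i => chartGen c j i) F) ∈
          maximalIdeal (Localization.AtPrime w.asIdeal) ^ μ := by
  subst hs
  -- (the structure map is given explicitly — unifying it from `hsq` is prohibitively slow — and
  -- `(ofHom φ).hom` is left unreduced: `simp`-normalising it is equally slow on the chart rings)
  have key := exists_stalk_ringHom_of_chart π x' (CommRingCat.ofHom (chartBase c j)) q w hq hsq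
  obtain ⟨χ, hχ, hloc, hw⟩ := key
  exact ⟨hw, fun F hF hFJ => algebraMap_eval₂Hom_mem_pow_of_isNear hcY j w χ hχ hloc hnear hF hFJ⟩

/-! ## Lemma 4.3 (3): uniqueness of the near point -/

set_option maxHeartbeats 800000 in
/-- **[CoP1] Lemma 4.3 (3): the near point over a point centre with `τ(x) = 2` is unique.** Let
`π` be the blowing up of the locally Noetherian `X` along a centre `Y` with `𝓘_{Y,x} = 𝔪_x =
(c_1, c_2, c_3)` at `x = π x′`, `𝒪_{X,x}` regular of dimension `3`, `𝒪_{X′,x′}` regular, and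
`τ(x) = 2`. If `x′` and `x″` are both near for `(J, μ)` (`ord J′ = μ` for the weak transform `J′`)
and `π x″ = π x′`, then `x″ = x′`. [cite: CossartPiltant2008, Lemma 4.3 (3); Hironaka1970, Thm. 2] -/
theorem IsBlowup.eq_of_isNear_of_isNear_point [IsLocallyNoetherian X] [IsLocallyNoetherian X']
    {Y : Closeds X} (hπ : IsBlowup π (vanishingIdeal Y)) {J : X.IdealSheafData} {μ : ℕ}
    {x' x'' : X'} [IsRegularLocalRing (X.presheaf.stalk (π x'))]
    [IsRegularLocalRing (X'.presheaf.stalk x')]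
    (hd : (maximalIdeal (X.presheaf.stalk (π x'))).spanFinrank = 3)
    {c : Fin 3 → X.presheaf.stalk (π x')} (hc : Ideal.span (Set.range c) = maximalIdeal _)
    (hcY : Ideal.span (Set.range c) = stalkIdeal (vanishingIdeal Y) (π x'))
    (hτ : stalkTau J (π x') μ = 2) (hnear : IsNear π (vanishingIdeal Y) J μ x')
    (hnear' : IsNear π (vanishingIdeal Y) J μ x'') (he : π x'' = π x') : x'' = x' := by
  classical
  -- (1) a regular system of parameters adapted to `x'`: `x'` is the origin of the chart `j`
  obtain ⟨c₂, j, 𝔴₀, χ₀, hc₂span, hc₂Y, hχ₀, hloc₀, h𝔴₀, he₀⟩ :=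
    hπ.exists_origin_chart_of_isNear_point hd hc hcY hτ hnear
  have hτc : hironakaTauAt c₂ (stalkIdeal J (π x')) μ = 2 := by
    rw [← stalkTau_eq J (π x') μ hd c₂ hc₂span]; exact hτ
  have h𝔴₀' : (maximalIdeal _).map (chartBase c₂ j) ≤ 𝔴₀.asIdeal := by
    rw [← h𝔴₀]; exact Ideal.map_comap_le
  have hnearF₀ : ∀ F : MvPolynomial (Fin 3) (X.presheaf.stalk (π x')), F.IsHomogeneous μ →
      MvPolynomial.eval c₂ F ∈ stalkIdeal J (π x') →
      (algebraMap (chartRing c₂ j) (Localization.AtPrime 𝔴₀.asIdeal) :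
          chartRing c₂ j →+* Localization.AtPrime 𝔴₀.asIdeal)
          (MvPolynomial.eval₂Hom (chartBase c₂ j) (fun i => chartGen c₂ j i) F) ∈
        maximalIdeal (Localization.AtPrime 𝔴₀.asIdeal) ^ μ :=
    fun F hF hFJ => algebraMap_eval₂Hom_mem_pow_of_isNear hc₂Y j 𝔴₀ χ₀ hχ₀ hloc₀ hnear hF hFJ
  -- the directrix in these coordinates lies in `⟨Y_i : i ≠ j⟩` (Hironaka's Theorem 2 at the origin)
  obtain ⟨ρ₀, -, -, hρ₀F, h𝔮₀, -, hS₀⟩ :=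
    exists_chartResidueMap_forall_initialForms_near hd c₂ hc₂span j 𝔴₀.asIdeal h𝔴₀' hnearF₀
  haveI := h𝔮₀
  have hq₀ : 𝔴₀.asIdeal.map ρ₀ = Ideal.span (Set.range (MvPolynomial.X : {i : Fin 3 // i ≠ j} →
      MvPolynomial {i : Fin 3 // i ≠ j} (ResidueField (X.presheaf.stalk (π x'))))) := by
    refine ((isMaximal_span_range_X_origin (k := ResidueField (X.presheaf.stalk (π x'))) j).eq_of_le
      (Ideal.IsPrime.ne_top h𝔮₀) ?_).symm
    rw [Ideal.span_le]
    rintro _ ⟨i, rfl⟩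
    rw [SetLike.mem_coe, ← map_chartGen_of_chartResidueMap c₂ j hρ₀F i.2]
    exact Ideal.mem_map_of_mem _ (he₀ i.1 i.2)
  have hdir := directrix_le_dualVanishingAt j (𝔴₀.asIdeal.map ρ₀) hS₀
  rw [hq₀] at hdir
  -- (2) hence EVERY near prime over `x` lies in the chart `j` of `c₂`
  have key : ∀ (j' : Fin 3) (𝔴 : Ideal (chartRing c₂ j')) [𝔴.IsPrime],
      (maximalIdeal _).map (chartBase c₂ j') ≤ 𝔴 →
      (∀ F : MvPolynomial (Fin 3) (X.presheaf.stalk (π x')), F.IsHomogeneous μ →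
        MvPolynomial.eval c₂ F ∈ stalkIdeal J (π x') →
        (algebraMap (chartRing c₂ j') (Localization.AtPrime 𝔴) :
            chartRing c₂ j' →+* Localization.AtPrime 𝔴)
            (MvPolynomial.eval₂Hom (chartBase c₂ j') (fun i => chartGen c₂ j' i) F) ∈
          maximalIdeal (Localization.AtPrime 𝔴) ^ μ) → j' = j := by
    intro j' 𝔴 _ h𝔴 hnear𝔴
    by_contra hne
    obtain ⟨-, -, -, -, -, a, ha, -⟩ :=
      exists_map_eq_span_of_near_point hd c₂ hc₂span j' 𝔴 h𝔴 hnear𝔴 hτc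
    have hj : j ≠ j' := fun h => hne h.symm
    -- `Y_j − a Y_{j'} ∈ T_x ⊆ ⟨Y_i : i ≠ j⟩`: its `Y_j`-coefficient `1` must vanish
    have h0 := apply_single_eq_zero_of_mem_dualVanishingAt_origin j (hdir (ha ⟨j, hj⟩))
    simp only [LinearMap.sub_apply, LinearMap.smul_apply, LinearMap.proj_apply, Pi.single_eq_same,
      Pi.single_eq_of_ne hne, smul_zero, sub_zero, one_ne_zero] at h0
  -- (3) one family of charts at `x` for `c₂`, through `x'` and `x''`
  obtain ⟨q, hqπ, hcov⟩ := hπ.exists_chartFamily (π x') c₂ hc₂Y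
  obtain ⟨j₁, w₁, hqw₁, hiso₁⟩ := hcov x' rfl
  obtain ⟨j₂, w₂, hqw₂, hiso₂⟩ := hcov x'' he
  haveI := hiso₁
  haveI := hiso₂
  obtain ⟨hw₁, hnear₁⟩ :=
    comap_eq_and_forall_near_forms_of_chart rfl hc₂Y j₁ w₁ (q j₁) hqw₁ (hqπ j₁) hnear
  obtain ⟨hw₂, hnear₂⟩ :=
    comap_eq_and_forall_near_forms_of_chart he hc₂Y j₂ w₂ (q j₂) hqw₂ (hqπ j₂) hnear'
  have hw₁' : (maximalIdeal _).map (chartBase c₂ j₁) ≤ w₁.asIdeal := by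
    rw [← hw₁]; exact Ideal.map_comap_le
  have hw₂' : (maximalIdeal _).map (chartBase c₂ j₂) ≤ w₂.asIdeal := by
    rw [← hw₂]; exact Ideal.map_comap_le
  have hj₁ : j₁ = j := key j₁ w₁.asIdeal hw₁' hnear₁
  have hj₂ : j₂ = j := key j₂ w₂.asIdeal hw₂' hnear₂
  subst hj₁
  subst hj₂
  -- (4) same chart: the chart-level uniqueness, and equal primes are equal points
  have heq : w₁.asIdeal = w₂.asIdeal :=
    eq_of_near_point_of_near_point hd c₂ hc₂span _ w₁.asIdeal w₂.asIdeal hw₁' hw₂' hnear₁ hnear₂ hτc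
  have hw : w₁ = w₂ := PrimeSpectrum.ext heq
  rw [← hqw₂, ← hw, hqw₁]

/-! ## Consequences: the near point is closed, of embedding dimension `3` -/

/-- The image of a near point over a point centre `𝓘_{Y,x} = 𝔪_x = (c)` lies in `Y` (private
plumbing). [folklore] -/
private theorem mem_centre_of_span_eq_stalkIdeal {Y : Closeds X} {x : X}
    {k : ℕ} {c : Fin k → X.presheaf.stalk x} (hc : Ideal.span (Set.range c) = maximalIdeal _)
    (hcY : Ideal.span (Set.range c) = stalkIdeal (vanishingIdeal Y) x) : x ∈ (Y : Set X) := by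
  rw [← coe_support_vanishingIdeal, SetLike.mem_coe, mem_support_iff_stalkIdeal_le, ← hcY, hc]

set_option maxHeartbeats 400000 in
/-- **The near point over a point centre with `τ(x) = 2` is a CLOSED point.** `X, X′` regular and
locally Noetherian, `π` the blowing up along a regular centre `Y` inside `{ord J = μ}` with
`𝓘_{Y,x} = 𝔪_x` at the CLOSED point `x = π x′` of embedding dimension `3`, `τ(x) = 2`, `x′` near:
then `{x′}` is closed in `X′`. (A specialization `z` of `x′` lies over `x`, so `ord_z J′ ≤ μ`; orders
do not decrease under specialization, so `z` is near; by uniqueness `z = x′`.)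
[cite: CossartPiltant2008, Lemma 4.3 (3)] -/
theorem IsBlowup.isClosed_singleton_of_isNear_point [IsLocallyNoetherian X] [IsLocallyNoetherian X']
    (hX : Scheme.IsRegular X) (hX' : Scheme.IsRegular X') {Y : Closeds X}
    (hreg : Scheme.IsRegular (vanishingIdeal Y).subscheme) (hπ : IsBlowup π (vanishingIdeal Y))
    {J : X.IdealSheafData} {μ : ℕ} (hY : ∀ y ∈ (Y : Set X), idealOrder J y = μ) {x' : X'}
    (hcl : IsClosed ({π x'} : Set X))
    (hd : haveI := hX (π x'); (maximalIdeal (X.presheaf.stalk (π x'))).spanFinrank = 3)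
    {c : Fin 3 → X.presheaf.stalk (π x')} (hc : Ideal.span (Set.range c) = maximalIdeal _)
    (hcY : Ideal.span (Set.range c) = stalkIdeal (vanishingIdeal Y) (π x'))
    (hτ : haveI := hX (π x'); stalkTau J (π x') μ = 2) (hnear : IsNear π (vanishingIdeal Y) J μ x') :
    IsClosed ({x'} : Set X') := by
  haveI := hX (π x')
  haveI := hX' x'
  rw [← closure_subset_iff_isClosed]
  intro z hz
  have hsp : x' ⤳ z := specializes_iff_mem_closure.mpr hz
  have hπz : π z = π x' := by
    have h : π x' ⤳ π z := hsp.map π.continuous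
    exact h.mem_closed hcl (Set.mem_singleton _)
  haveI : IsRegularLocalRing (X'.presheaf.stalk z) := hX' z
  have hle : idealOrder (controlledTransform π (vanishingIdeal Y) J μ) z ≤ μ := by
    have hx : π z ∈ (Y : Set X) := by
      rw [hπz]; exact mem_centre_of_span_eq_stalkIdeal hc hcY
    exact hπ.idealOrder_controlledTransform_le_of_mem hX hreg hY hx
  have hge : (μ : ℕ∞) ≤ idealOrder (controlledTransform π (vanishingIdeal Y) J μ) z :=
    (isNear_iff.mp hnear).ge.trans (idealOrder_le_of_specializes hsp _)
  have hnz : IsNear π (vanishingIdeal Y) J μ z := isNear_iff.mpr (le_antisymm hle hge)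
  exact hπ.eq_of_isNear_of_isNear_point hd hc hcY hτ hnear hnz hπz

/-- **The near point over a point centre with `τ(x) = 2` is again a point of embedding dimension
`3`**: `dim 𝒪_{X′,x′} = 3` (it is the origin of a chart of the blowing up of the regular
`3`-dimensional `𝒪_{X,x}`). [cite: CossartPiltant2008, Lemma 4.3 (3), proof] -/
theorem IsBlowup.spanFinrank_eq_three_of_isNear_point [IsLocallyNoetherian X]
    [IsLocallyNoetherian X'] {Y : Closeds X} (hπ : IsBlowup π (vanishingIdeal Y))
    {J : X.IdealSheafData} {μ : ℕ} {x' : X'} [IsRegularLocalRing (X.presheaf.stalk (π x'))]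
    [IsRegularLocalRing (X'.presheaf.stalk x')]
    (hd : (maximalIdeal (X.presheaf.stalk (π x'))).spanFinrank = 3)
    {c : Fin 3 → X.presheaf.stalk (π x')} (hc : Ideal.span (Set.range c) = maximalIdeal _)
    (hcY : Ideal.span (Set.range c) = stalkIdeal (vanishingIdeal Y) (π x'))
    (hτ : stalkTau J (π x') μ = 2) (hnear : IsNear π (vanishingIdeal Y) J μ x') :
    (maximalIdeal (X'.presheaf.stalk x')).spanFinrank = 3 := by
  obtain ⟨c₂, j, 𝔴, χ, hc₂span, -, -, hloc, h𝔴, he⟩ :=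
    hπ.exists_origin_chart_of_isNear_point hd hc hcY hτ hnear
  letI := χ.toAlgebra
  haveI : IsLocalization.AtPrime (X'.presheaf.stalk x') 𝔴.asIdeal := hloc
  exact (isRegularLocalRing_and_span_originFamily hd c₂ hc₂span j 𝔴.asIdeal h𝔴 he
    (X'.presheaf.stalk x')).2.1

end Literature.AlgebraicGeometry.Resolution

end
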